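import Summits.Langlands.Langlands.Theorems.RamifiedCoefficientSeedAdjointLiftingGL3BirthDefs2
import Literature.NumberTheory.GaloisRepresentations.SerreWeightExistenceProofs
import HarnessLib

/-!
# Crux `AdjointLiftingGL3` (stmt-Langlands-16779), line `birth`: stub `stub_localInertialType`,
# part 3 — characteristic polynomials of `χ ⊗ ad⁰ V` and the inertial frames of `V`

Third helper file of stub `stub_localInertialType` (CORE-A of S2a, skeleton v6); independent of
parts 1–2.

* §1 `univ_val_map_eq_of_isTwistedAdZero`: for `T = P (χ · Ad⁰ V) P⁻¹` (`IsTwistedAdZero`), if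
  `T(g)` is conjugate to an upper triangular matrix of diagonal `d` and `V(g)` to an upper triangular
  matrix of diagonal `(α, β)`, then `{d₀, d₁, d₂} = {x, x α/β, x β/α}` (`x = χ(g)`): both sides are
  the root multiset of `charpoly T(g) = charpoly (x · Ad⁰ V(g)) = (X − x)(X² − x(tr²/det − 2)X + x²)`
  (accepted `charpoly_smul_adZeroTwoMatrixOf`).
* §2 `exists_det_eq_fundamentalCharacter_pow`: a continuous character `Γ_K → GL₁(k)` (`k` discrete)
  is a power `ω^c` of the level-one fundamental character on `I_K` (finite image of order prime to
  `p` on the prime-to-`p` part, `exists_eq_kummerCharacter_pow_holds`, Frobenius invariance and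
  `kummerCharacter_conj_apply`: `x^q = x`).
* §3 the inertial frames of a two-dimensional `V` (Serre's Prop. 1 with frames, after the accepted
  `exists_isLevelOneWildWeight` / `exists_isLevelTwoWeight_or_isLevelOneTameWeight` of
  `SerreWeightShapeProofs`, but keeping the frame): `exists_wild_frame` (not tame: triangular on all of
  `Γ_K`, inertial diagonal `(ω^{b₀}, ω^{b₁})`), `exists_tame_frame` (tame: diagonal on `I_K`, either
  `(ω^{b₀}, ω^{b₁})` or `(ψ₂^n, ψ₂^{qn})`).
References: Serre 1972 §1.7; Serre 1987 §2.1–2.4; Fontaine–Laffaille 1982 Thm. 5.3.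
-/

set_option linter.dupNamespace false -- `Summit.Langlands.Langlands` is the mandated namespace

noncomputable section

namespace Summit.Langlands.Langlands.Cruxes.AdjointLiftingGL3.Birth

open scoped MatrixGroups Polynomial
open Field ValuativeRel Polynomial
open Literature.NumberTheory.GaloisRepresentations
open Literature.NumberTheory.GaloisRepresentations.IsNonarchimedeanLocalField
open Literature.NumberTheory.GaloisRepresentations.ModPGaloisRep.InertiaShape

/-! ## §1. The root multiset of `charpoly (χ · Ad⁰ V)` -/

section AdZero

variable {G : Type*} [Group G] {k : Type*} [Field k]

/-- **`{d₀, d₁, d₂} = {x, x α/β, x β/α}`.**  For `T = P (χ · Ad⁰ V) P⁻¹` (`IsTwistedAdZero T V χ`),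
if `T(g)` is conjugate to an upper triangular matrix with diagonal `d` and `V(g)` to an upper
triangular matrix with diagonal `(α, β)`, then the multiset of the `d_i` is `{x, x α/β, x β/α}`,
`x = χ(g)`: compare the root multisets of `charpoly T(g) = ∏ (X − d_i)` and
`charpoly (x · Ad⁰ V(g)) = (X − x)(X² − x (tr² / det − 2) X + x²) = (X − x)(X − xα/β)(X − xβ/α)`.
[folklore] -/
theorem univ_val_map_eq_of_isTwistedAdZero {T : G →* GL (Fin 3) k} {V : G →* GL (Fin 2) k}
    {χ : G →* GL (Fin 1) k} (hTw : IsTwistedAdZero T V χ) (g : G) {PT : GL (Fin 3) k}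
    {d : Fin 3 → k}
    (hup : ∀ i j : Fin 3, j < i →
      ((PT * T g * PT⁻¹ : GL (Fin 3) k) : Matrix (Fin 3) (Fin 3) k) i j = 0)
    (hdiag : ∀ i : Fin 3, ((PT * T g * PT⁻¹ : GL (Fin 3) k) : Matrix (Fin 3) (Fin 3) k) i i = d i)
    {P₂ : GL (Fin 2) k} (h10 : ((P₂ * V g * P₂⁻¹ : GL (Fin 2) k) : Matrix (Fin 2) (Fin 2) k) 1 0 = 0) :
    (Finset.univ : Finset (Fin 3)).val.map d =
      {((χ g : GL (Fin 1) k) : Matrix (Fin 1) (Fin 1) k) 0 0,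
        ((χ g : GL (Fin 1) k) : Matrix (Fin 1) (Fin 1) k) 0 0 *
          ((P₂ * V g * P₂⁻¹ : GL (Fin 2) k) : Matrix (Fin 2) (Fin 2) k) 0 0 /
          ((P₂ * V g * P₂⁻¹ : GL (Fin 2) k) : Matrix (Fin 2) (Fin 2) k) 1 1,
        ((χ g : GL (Fin 1) k) : Matrix (Fin 1) (Fin 1) k) 0 0 *
          ((P₂ * V g * P₂⁻¹ : GL (Fin 2) k) : Matrix (Fin 2) (Fin 2) k) 1 1 /
          ((P₂ * V g * P₂⁻¹ : GL (Fin 2) k) : Matrix (Fin 2) (Fin 2) k) 0 0} := by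
  obtain ⟨P, hP⟩ := hTw
  set x := ((χ g : GL (Fin 1) k) : Matrix (Fin 1) (Fin 1) k) 0 0 with hx
  set U : GL (Fin 2) k := P₂ * V g * P₂⁻¹ with hUdef
  set a := (U : Matrix (Fin 2) (Fin 2) k) 0 0 with ha
  set b := (U : Matrix (Fin 2) (Fin 2) k) 1 1 with hb
  have hU : (U : Matrix (Fin 2) (Fin 2) k) = !![a, (U : Matrix (Fin 2) (Fin 2) k) 0 1; 0, b] := by
    conv_lhs => rw [Matrix.eta_fin_two (U : Matrix (Fin 2) (Fin 2) k), h10]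
  have hconj : (V g : Matrix (Fin 2) (Fin 2) k) =
      ((P₂⁻¹ : GL (Fin 2) k) : Matrix (Fin 2) (Fin 2) k) * (U : Matrix (Fin 2) (Fin 2) k) *
        (((P₂⁻¹)⁻¹ : GL (Fin 2) k) : Matrix (Fin 2) (Fin 2) k) := by
    rw [← Units.val_mul, ← Units.val_mul, hUdef]; congr 1; group
  have htr : (V g : Matrix (Fin 2) (Fin 2) k).trace = a + b := by
    rw [hconj, Matrix.trace_units_conj, hU, Matrix.trace_fin_two_of]
  have hdet : ((Matrix.GeneralLinearGroup.det (V g) : kˣ) : k) = a * b := by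
    rw [Matrix.GeneralLinearGroup.val_det_apply, hconj, Matrix.det_units_conj, hU,
      Matrix.det_fin_two_of]
    ring
  have hab : a * b ≠ 0 := by rw [← hdet]; exact (Matrix.GeneralLinearGroup.det (V g)).ne_zero
  have ha0 : a ≠ 0 := left_ne_zero_of_mul hab
  have hb0 : b ≠ 0 := right_ne_zero_of_mul hab
  -- `charpoly T(g) = ∏ (X - d i)`
  have h1 : (T g : Matrix (Fin 3) (Fin 3) k).charpoly = ∏ i : Fin 3, (X - C (d i)) := by
    have hBT : ((PT * T g * PT⁻¹ : GL (Fin 3) k) : Matrix (Fin 3) (Fin 3) k).BlockTriangular id :=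
      fun i j hij => hup i j hij
    have key := Matrix.charpoly_of_upperTriangular _ hBT
    simp only [hdiag] at key
    rwa [Units.val_mul, Units.val_mul, Matrix.coe_units_inv, Matrix.charpoly_units_conj] at key
  -- `charpoly T(g) = (X - x)(X - x a / b)(X - x b / a)`
  have h2 : (T g : Matrix (Fin 3) (Fin 3) k).charpoly =
      (X - C x) * ((X - C (x * a / b)) * (X - C (x * b / a))) := by
    rw [hP g, Matrix.coe_units_inv, Matrix.charpoly_units_conj P]
    change (x • ((glAdZeroTwoFrame k (V g) : GL (Fin 3) k) : Matrix (Fin 3) (Fin 3) k)).charpoly = _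
    rw [coe_glAdZeroTwoFrame_apply, coe_inv_eq_smul_fin_two, Units.smul_def,
      charpoly_smul_adZeroTwoMatrixOf (V g : Matrix (Fin 2) (Fin 2) k) _ _
        (by rw [← Matrix.GeneralLinearGroup.val_det_apply, Units.inv_mul]),
      htr, Units.val_inv_eq_inv_val, hdet]
    congr 1
    have e1 : x * ((a + b) ^ 2 * (a * b)⁻¹ - 2) = x * a / b + x * b / a := by
      field_simp; ring
    have e2 : x ^ 2 = (x * a / b) * (x * b / a) := by
      field_simp
    rw [e1, e2, map_add, map_mul]
    ring
  -- compare the roots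
  have key : (((Finset.univ : Finset (Fin 3)).val.map d).map fun r => X - C r).prod =
      ((({x, x * a / b, x * b / a} : Multiset k)).map fun r => X - C r).prod := by
    rw [Multiset.map_map, ← Finset.prod_eq_multiset_prod]
    change ∏ i : Fin 3, (X - C (d i)) = _
    rw [← h1, h2]
    simp [Multiset.insert_eq_cons]
  have := congrArg Polynomial.roots key
  rwa [Polynomial.roots_multiset_prod_X_sub_C, Polynomial.roots_multiset_prod_X_sub_C] at this

end AdZero

/-! ## §2. A character of `Γ_K` is a power of `ω` on inertia -/

section Character

variable {K : Type} [Field K] [ValuativeRel K] [TopologicalSpace K] [IsNonarchimedeanLocalField K]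
variable {k : Type*} [Field k] [TopologicalSpace k]

/-- **A continuous character `Γ_K → GL₁(k)` (`k` discrete) is `ω^c` on `I_K`.**  Its restriction
`x` to `I_K` (as `det : GL₁ → kˣ`) is continuous of finite order, hence of exponent `d` prime to
`p` and a power of the Kummer character `θ_d` (`exists_eq_kummerCharacter_pow_holds`); since `x`
extends to a character of `Γ_K` it is invariant under conjugation by a Frobenius `τ`, while
`θ_d(τστ⁻¹) = θ_d(σ)^q` (`kummerCharacter_conj_apply`): `x^q = x`, so `x^{q−1} = 1` and
`x = θ_{q−1}^c = ω^c` (this is the argument of the accepted `exists_isLevelOneWildWeight` for the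
diagonal characters). [cite: Serre1987, §2.1 Prop. 1 (proof)] [cite: SerreInventiones1972, §1.7 Prop. 5] -/
theorem exists_det_eq_fundamentalCharacter_pow [DiscreteTopology k] (χ : ModPGaloisRep K k 1)
    (ι : absIntegers 𝒪[K] K ⧸ absMaximalIdeal K →+* k) (ϖ : 𝒪[K]) (hϖ : Irreducible ϖ) :
    ∃ c : ℕ, ∀ σ : absInertia K,
      Matrix.GeneralLinearGroup.det (χ (σ : absoluteGaloisGroup K)) =
        fundamentalCharacter K 1 ι ϖ hϖ σ ^ c := by
  classical
  haveI : Fact (ringChar 𝓀[K]).Prime := ⟨ringChar_residueField_prime⟩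
  haveI : CharP k (ringChar 𝓀[K]) := charP_of_residueEmbedding ι
  set x : absoluteGaloisGroup K →* kˣ :=
    (Matrix.GeneralLinearGroup.det : GL (Fin 1) k →* kˣ).comp χ.toMonoidHom with hxdef
  set xI : absInertia K →* kˣ := x.comp (absInertia K).subtype with hxI
  have hxI_apply : ∀ σ : absInertia K,
      xI σ = Matrix.GeneralLinearGroup.det (χ (σ : absoluteGaloisGroup K)) := fun σ => rfl
  -- continuity (`GL₁(k)` is discrete)
  have hcont : Continuous xI :=
    (continuous_of_discreteTopology (f := (Matrix.GeneralLinearGroup.det : GL (Fin 1) k → kˣ))).comp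
      (χ.continuous_toFun.comp continuous_subtype_val)
  -- finite order
  set R : Subgroup (GL (Fin 1) k) := χ.toMonoidHom.range with hR
  haveI : Finite R := by
    have : (R : Set (GL (Fin 1) k)).Finite := by
      rw [hR, MonoidHom.coe_range]; exact finite_range_local χ
    exact this.to_subtype
  set N := Nat.card R with hN
  have hN0 : N ≠ 0 := Nat.card_pos.ne'
  have hχN : ∀ g : absoluteGaloisGroup K, χ g ^ N = 1 := fun g => by
    have := pow_card_eq_one' (x := (⟨χ.toMonoidHom g, ⟨g, rfl⟩⟩ : R))
    exact congrArg Subtype.val this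
  have hxN : ∀ σ : absInertia K, xI σ ^ N = 1 := fun σ => by
    rw [hxI_apply, ← map_pow, hχN, map_one]
  obtain ⟨d, hd, hpd, hxd⟩ := exists_pow_eq_one_not_dvd xI hN0 hxN
  obtain ⟨a, ha⟩ := exists_eq_kummerCharacter_pow_holds K k ι hd hpd hϖ xI hcont hxd
  -- Frobenius invariance: `x ^ q = x` on `I_K`
  obtain ⟨τ, hτ⟩ := exists_isFrobPow_holds K 1
  have hlevel : ∀ σ : absInertia K, xI σ ^ (residueFieldCard K ^ 1 - 1) = 1 := by
    intro σ
    rw [pow_one]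
    refine pow_sub_one_eq_one_of_pow_eq_self (one_lt_residueFieldCard K).le ?_
    have hmem : τ * (σ : absoluteGaloisGroup K) * τ⁻¹ ∈ absInertia K :=
      (absInertia_normal_holds K).conj_mem _ σ.2 τ
    have hτ' : IsFrobPow τ ((1 : ℕ) : ℤ) := hτ
    have key := kummerCharacter_conj_apply hd hϖ.ne_zero ι hτ' σ hmem
    rw [pow_one] at key
    have h2 : xI ⟨τ * σ * τ⁻¹, hmem⟩ = xI σ := by
      change x (τ * σ * τ⁻¹) = x σ
      rw [map_mul, map_mul, map_inv, mul_inv_cancel_comm]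
    have e1 : ((xI ⟨τ * σ * τ⁻¹, hmem⟩ : kˣ) : k) = ((xI σ : kˣ) : k) ^ residueFieldCard K := by
      rw [ha, MonoidHom.pow_apply, MonoidHom.pow_apply, Units.val_pow_eq_pow_val,
        Units.val_pow_eq_pow_val, key, ← pow_mul, ← pow_mul, mul_comm]
    rw [h2] at e1
    exact Units.ext (by rw [Units.val_pow_eq_pow_val]; exact e1.symm)
  obtain ⟨c, hc⟩ := exists_eq_kummerCharacter_pow_holds K k ι
    (residueFieldCard_pow_sub_one_pos K one_ne_zero) (not_ringChar_dvd_pow_sub_one one_ne_zero) hϖ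
    xI hcont hlevel
  rw [← fundamentalCharacter_of_ne_zero K one_ne_zero ι ϖ hϖ] at hc
  exact ⟨c, fun σ => by rw [← hxI_apply, hc, MonoidHom.pow_apply]⟩

end Character

/-! ## §3. The inertial frames of a two-dimensional `V` (Serre's Prop. 1 with frames) -/

section Frames

variable {K : Type} [Field K] [ValuativeRel K] [TopologicalSpace K] [IsNonarchimedeanLocalField K]
variable {k : Type*} [Field k] [TopologicalSpace k]

/-- **The wild frame.**  If `ρ̄ : Γ_K → GL₂(k)` (`k` discrete) is not tamely ramified, there is a
basis in which `ρ̄` is upper triangular on ALL of `Γ_K` (the fixed line of the wild inertia,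
`exists_common_eigenvector_of_not_isTamelyRamified`, `exists_conj_triangular`) with inertial diagonal
characters `(ω^{b₀}, ω^{b₁})` (Frobenius invariance, `diagChar_conj_eq_pow`, and
`exists_eq_kummerCharacter_pow_holds`) — the argument of the accepted `exists_isLevelOneWildWeight`,
keeping the frame and the given uniformiser. [cite: Serre1987, §2.1 Prop. 1 and §2.4 (2.4.1)–(2.4.3)] -/
theorem exists_wild_frame [DiscreteTopology k] (ρ : ModPGaloisRep K k 2)
    (ι : absIntegers 𝒪[K] K ⧸ absMaximalIdeal K →+* k) (ϖ : 𝒪[K]) (hϖ : Irreducible ϖ)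
    (hw : ¬ ρ.IsTamelyRamified) :
    ∃ (P : GL (Fin 2) k) (b₀ b₁ : ℕ),
      (∀ g : absoluteGaloisGroup K, ((P * ρ g * P⁻¹ : GL (Fin 2) k) : Matrix (Fin 2) (Fin 2) k) 1 0 = 0) ∧
      ∀ σ : absInertia K,
        ((P * ρ (σ : absoluteGaloisGroup K) * P⁻¹ : GL (Fin 2) k) : Matrix (Fin 2) (Fin 2) k) 0 0 =
          ((fundamentalCharacter K 1 ι ϖ hϖ σ ^ b₀ : kˣ) : k) ∧
        ((P * ρ (σ : absoluteGaloisGroup K) * P⁻¹ : GL (Fin 2) k) : Matrix (Fin 2) (Fin 2) k) 1 1 =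
          ((fundamentalCharacter K 1 ι ϖ hϖ σ ^ b₁ : kˣ) : k) := by
  classical
  haveI : Fact (ringChar 𝓀[K]).Prime := ⟨ringChar_residueField_prime⟩
  have hfin : ModPGaloisRep.finite_range (K := K) (k := k) (n := 2) := finite_range_local
  have hN4 : exists_eq_kummerCharacter_pow K k := exists_eq_kummerCharacter_pow_holds K k
  obtain ⟨v, hv, hev⟩ := exists_common_eigenvector_of_not_isTamelyRamified hfin
    (absUpperInertia_map_isPGroup_holds K (GL (Fin 2) k)) ρ ι hw
  obtain ⟨P, hP⟩ := exists_conj_triangular ρ hv hev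
  have hf : ∀ σ, (conjRestrict ρ P σ : Matrix (Fin 2) (Fin 2) k) 1 0 = 0 := fun σ => hP σ
  have hfΓ : ∀ g, (conjHom ρ P g : Matrix (Fin 2) (Fin 2) k) 1 0 = 0 := fun g => hP g
  obtain ⟨τ, hτ⟩ := exists_isFrobPow_holds K 1
  obtain ⟨d, hd, hpd, hχd⟩ := exists_diagChar_pow_eq_one hfin ρ ι P hf
  have hlevel' : ∀ (i : Fin 2) (σ : absInertia K),
      diagChar (conjRestrict ρ P) hf i σ ^ (residueFieldCard K ^ 1 - 1) = 1 := by
    intro i σ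
    rw [pow_one]
    refine pow_sub_one_eq_one_of_pow_eq_self (one_lt_residueFieldCard K).le ?_
    have hmem : τ * (σ : absoluteGaloisGroup K) * τ⁻¹ ∈ absInertia K :=
      (absInertia_normal_holds K).conj_mem _ σ.2 τ
    have h1 := diagChar_conj_eq_pow hN4 ρ ι P hf i hd hpd (hχd i) hτ σ hmem
    have h2 : (diagChar (conjRestrict ρ P) hf i ⟨τ * σ * τ⁻¹, hmem⟩ : k) =
        (diagChar (conjRestrict ρ P) hf i σ : k) := by
      change (diagChar (conjHom ρ P) hfΓ i (τ * σ * τ⁻¹) : k) = (diagChar (conjHom ρ P) hfΓ i σ : k)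
      rw [map_mul, map_mul, map_inv, mul_inv_cancel_comm]
    rw [h2] at h1
    exact Units.ext (by rw [Units.val_pow_eq_pow_val]; exact h1.symm)
  have hq1 : ¬ ringChar 𝓀[K] ∣ residueFieldCard K ^ 1 - 1 := not_ringChar_dvd_pow_sub_one one_ne_zero
  obtain ⟨b₀, hb₀⟩ := hN4 ι (residueFieldCard_pow_sub_one_pos K one_ne_zero) hq1 hϖ
    (diagChar (conjRestrict ρ P) hf 0) (continuous_diagChar_conjRestrict ρ P hf 0) (hlevel' 0)
  obtain ⟨b₁, hb₁⟩ := hN4 ι (residueFieldCard_pow_sub_one_pos K one_ne_zero) hq1 hϖ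
    (diagChar (conjRestrict ρ P) hf 1) (continuous_diagChar_conjRestrict ρ P hf 1) (hlevel' 1)
  rw [← fundamentalCharacter_of_ne_zero K one_ne_zero ι ϖ hϖ] at hb₀ hb₁
  refine ⟨P, b₀, b₁, hP, fun σ => ⟨?_, ?_⟩⟩
  · rw [← conjRestrict_apply, ← coe_diagChar_apply (conjRestrict ρ P) hf 0 σ, hb₀, MonoidHom.pow_apply]
  · rw [← conjRestrict_apply, ← coe_diagChar_apply (conjRestrict ρ P) hf 1 σ, hb₁, MonoidHom.pow_apply]

/-- **The tame frame.**  If `ρ̄ : Γ_K → GL₂(k)` (`k` discrete) is tamely ramified, there is a basis in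
which `ρ̄|_{I_K}` is diagonal (`exists_conj_diagonal_of_isTamelyRamified`), with diagonal characters
either both of level one, `(ω^{b₀}, ω^{b₁})`, or conjugate of level two, `(ψ₂^n, ψ₂^{qn})` (Serre's
dichotomy `level_dichotomy`: Frobenius acts on the diagonal characters by `u ↦ u^q` and preserves
the pair) — the argument of the accepted `exists_isLevelTwoWeight_or_isLevelOneTameWeight`, keeping
the frame and the given uniformiser. [cite: Serre1987, §2.1 Prop. 1, §2.2 (2.2.1), §2.3 (2.3.1)] -/
theorem exists_tame_frame [DiscreteTopology k] (ρ : ModPGaloisRep K k 2)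
    (ι : absIntegers 𝒪[K] K ⧸ absMaximalIdeal K →+* k) (ϖ : 𝒪[K]) (hϖ : Irreducible ϖ)
    (ht : ρ.IsTamelyRamified) :
    ∃ P : GL (Fin 2) k,
      (∃ b₀ b₁ : ℕ, ∀ σ : absInertia K,
        ((P * ρ (σ : absoluteGaloisGroup K) * P⁻¹ : GL (Fin 2) k) : Matrix (Fin 2) (Fin 2) k) =
          !![((fundamentalCharacter K 1 ι ϖ hϖ σ ^ b₀ : kˣ) : k), 0;
            0, ((fundamentalCharacter K 1 ι ϖ hϖ σ ^ b₁ : kˣ) : k)]) ∨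
      (∃ n : ℕ, ∀ σ : absInertia K,
        ((P * ρ (σ : absoluteGaloisGroup K) * P⁻¹ : GL (Fin 2) k) : Matrix (Fin 2) (Fin 2) k) =
          !![((fundamentalCharacter K 2 ι ϖ hϖ σ ^ n : kˣ) : k), 0;
            0, ((fundamentalCharacter K 2 ι ϖ hϖ σ ^ (residueFieldCard K * n) : kˣ) : k)]) := by
  classical
  haveI : Fact (ringChar 𝓀[K]).Prime := ⟨ringChar_residueField_prime⟩
  have hfin : ModPGaloisRep.finite_range (K := K) (k := k) (n := 2) := finite_range_local
  have hN4 : exists_eq_kummerCharacter_pow K k := exists_eq_kummerCharacter_pow_holds K k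
  obtain ⟨P, hP⟩ := exists_conj_diagonal_of_isTamelyRamified
    (absInertia_map_isCyclic_holds K (GL (Fin 2) k)) ρ ι ht
  have hf : ∀ σ, (conjRestrict ρ P σ : Matrix (Fin 2) (Fin 2) k) 1 0 = 0 := fun σ => (hP σ).1
  have hf01 : ∀ σ, (conjRestrict ρ P σ : Matrix (Fin 2) (Fin 2) k) 0 1 = 0 := fun σ => (hP σ).2
  have hdiag : ∀ σ, (conjRestrict ρ P σ : Matrix (Fin 2) (Fin 2) k) =
      !![(diagChar (conjRestrict ρ P) hf 0 σ : k), 0; 0, (diagChar (conjRestrict ρ P) hf 1 σ : k)] := by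
    intro σ
    rw [eq_of_diagChar (conjRestrict ρ P) hf σ, hf01 σ]
  obtain ⟨τ, hτ⟩ := exists_isFrobPow_holds K 1
  obtain ⟨d, hd, hpd, hχd⟩ := exists_diagChar_pow_eq_one hfin ρ ι P hf
  set q := residueFieldCard K with hqdef
  have hpair : ∀ σ : absInertia K,
      (diagChar (conjRestrict ρ P) hf 0 σ ^ q = diagChar (conjRestrict ρ P) hf 0 σ ∧
        diagChar (conjRestrict ρ P) hf 1 σ ^ q = diagChar (conjRestrict ρ P) hf 1 σ) ∨
      (diagChar (conjRestrict ρ P) hf 0 σ ^ q = diagChar (conjRestrict ρ P) hf 1 σ ∧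
        diagChar (conjRestrict ρ P) hf 1 σ ^ q = diagChar (conjRestrict ρ P) hf 0 σ) := by
    intro σ
    have hmem : τ * (σ : absoluteGaloisGroup K) * τ⁻¹ ∈ absInertia K :=
      (absInertia_normal_holds K).conj_mem _ σ.2 τ
    have e0 := diagChar_conj_eq_pow hN4 ρ ι P hf 0 hd hpd (hχd 0) hτ σ hmem
    have e1 := diagChar_conj_eq_pow hN4 ρ ι P hf 1 hd hpd (hχd 1) hτ σ hmem
    set T : GL (Fin 2) k := P * ρ τ * P⁻¹ with hT
    have hconj : conjRestrict ρ P ⟨τ * σ * τ⁻¹, hmem⟩ = T * conjRestrict ρ P σ * T⁻¹ := by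
      rw [conjRestrict_apply, conjRestrict_apply, hT]
      change P * ρ (τ * σ * τ⁻¹) * P⁻¹ = _
      rw [map_mul, map_mul, map_inv]
      group
    have htr : ((conjRestrict ρ P ⟨τ * σ * τ⁻¹, hmem⟩ : GL (Fin 2) k) : Matrix (Fin 2) (Fin 2) k).trace =
        ((conjRestrict ρ P σ : GL (Fin 2) k) : Matrix (Fin 2) (Fin 2) k).trace := by
      rw [hconj, Matrix.GeneralLinearGroup.coe_mul, Matrix.GeneralLinearGroup.coe_mul,
        Matrix.trace_units_conj]
    have hdet : ((conjRestrict ρ P ⟨τ * σ * τ⁻¹, hmem⟩ : GL (Fin 2) k) : Matrix (Fin 2) (Fin 2) k).det =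
        ((conjRestrict ρ P σ : GL (Fin 2) k) : Matrix (Fin 2) (Fin 2) k).det := by
      rw [hconj, Matrix.GeneralLinearGroup.coe_mul, Matrix.GeneralLinearGroup.coe_mul,
        Matrix.det_units_conj]
    rw [hdiag, hdiag, Matrix.trace_fin_two_of, Matrix.trace_fin_two_of, e0, e1] at htr
    rw [hdiag, hdiag, Matrix.det_fin_two_of, Matrix.det_fin_two_of, e0, e1] at hdet
    simp only [mul_zero, sub_zero] at hdet
    rcases eq_or_eq_of_add_eq_of_mul_eq htr hdet with h | h
    · left
      exact ⟨Units.ext (by rw [Units.val_pow_eq_pow_val]; exact h.1),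
        Units.ext (by rw [Units.val_pow_eq_pow_val]; exact h.2)⟩
    · right
      exact ⟨Units.ext (by rw [Units.val_pow_eq_pow_val]; exact h.1),
        Units.ext (by rw [Units.val_pow_eq_pow_val]; exact h.2)⟩
  have hq2 : 2 ≤ q := one_lt_residueFieldCard K
  refine ⟨P, ?_⟩
  rcases level_dichotomy _ _ q hpair with hone | ⟨htwo, -⟩
  · ---------------------------------------------------------------- level one
    left
    have hlevel' : ∀ (i : Fin 2) (σ : absInertia K),
        diagChar (conjRestrict ρ P) hf i σ ^ (residueFieldCard K ^ 1 - 1) = 1 := fun i σ => by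
      rw [pow_one]
      refine pow_sub_one_eq_one_of_pow_eq_self (one_lt_residueFieldCard K).le ?_
      fin_cases i
      · exact (hone σ).1
      · exact (hone σ).2
    have hq1 : ¬ ringChar 𝓀[K] ∣ residueFieldCard K ^ 1 - 1 := not_ringChar_dvd_pow_sub_one one_ne_zero
    obtain ⟨b₀, hb₀⟩ := hN4 ι (residueFieldCard_pow_sub_one_pos K one_ne_zero) hq1 hϖ
      (diagChar (conjRestrict ρ P) hf 0) (continuous_diagChar_conjRestrict ρ P hf 0) (hlevel' 0)
    obtain ⟨b₁, hb₁⟩ := hN4 ι (residueFieldCard_pow_sub_one_pos K one_ne_zero) hq1 hϖ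
      (diagChar (conjRestrict ρ P) hf 1) (continuous_diagChar_conjRestrict ρ P hf 1) (hlevel' 1)
    rw [← fundamentalCharacter_of_ne_zero K one_ne_zero ι ϖ hϖ] at hb₀ hb₁
    refine ⟨b₀, b₁, fun σ => ?_⟩
    rw [← conjRestrict_apply, hdiag σ, hb₀, hb₁, MonoidHom.pow_apply, MonoidHom.pow_apply]
  · ---------------------------------------------------------------- level two
    right
    have hq21 : ¬ ringChar 𝓀[K] ∣ residueFieldCard K ^ 2 - 1 := not_ringChar_dvd_pow_sub_one two_ne_zero
    have hlevel2 : ∀ σ : absInertia K,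
        diagChar (conjRestrict ρ P) hf 0 σ ^ (residueFieldCard K ^ 2 - 1) = 1 := fun σ => by
      refine pow_sub_one_eq_one_of_pow_eq_self (Nat.one_le_pow _ _ (by omega)) ?_
      rw [pow_two, pow_mul, (htwo σ).1, (htwo σ).2]
    obtain ⟨n, hn⟩ := hN4 ι (residueFieldCard_pow_sub_one_pos K two_ne_zero) hq21 hϖ
      (diagChar (conjRestrict ρ P) hf 0) (continuous_diagChar_conjRestrict ρ P hf 0) hlevel2
    rw [← fundamentalCharacter_of_ne_zero K two_ne_zero ι ϖ hϖ] at hn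
    refine ⟨n, fun σ => ?_⟩
    have e1 : diagChar (conjRestrict ρ P) hf 1 σ = fundamentalCharacter K 2 ι ϖ hϖ σ ^ (q * n) := by
      rw [← (htwo σ).1, hn, MonoidHom.pow_apply, ← pow_mul, mul_comm]
    rw [← conjRestrict_apply, hdiag σ, e1, hn, MonoidHom.pow_apply]

end Frames

end Summit.Langlands.Langlands.Cruxes.AdjointLiftingGL3.Birth

end
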